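import Literature.Analysis.UnboundedOperators.HeatFlowCalculus
import Literature.Analysis.UnboundedOperators.CaloricFourierSynthesis
import Mathlib.Analysis.Distribution.SchwartzSpace.Fourier
import Mathlib.Analysis.Fourier.Inversion
import HarnessLib

/-!
# Heat-subordinated Riesz-type multipliers: `𝓕⁻[𝓕(∂ₐ∂_b∂_c S)/(4π²|ξ|²)] ∈ L¹`

Analysis/FluidPDE support file (everything **proved**; no definitions) for the discharge of the
named fact `Literature.Analysis.FluidPDE.exists_taoAverageData_op_eq_eulerBilinear`
(`TaoAveragedEuler.lean`; T. Tao, *Finite time blowup for an averaged three-dimensional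
Navier–Stokes equation*, J. Amer. Math. Soc. 29 (2016), §1.1: the Euler bilinear operator
`B(u,v) = -½ P[(u·∇)v + (v·∇)u]` is itself an averaged Euler bilinear operator, with the trivial
averaging). In the tree's function-level formalisation this requires `B(u,v) ∈ L¹(ℝ³)` for
Schwartz divergence-free `u v`, i.e. that the kernel of the Leray symbol `ξ ⊗ ξ/|ξ|²` applied to
the divergence `div (u ⊗ v + v ⊗ u)` is integrable; the singular part of `P̂ ŵ` is a sum of
third-order Riesz-type multipliers `ξₐ ξ_b ξ_c T̂(ξ)/|ξ|²` of Schwartz functions `T`.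

Let `V` be a finite-dimensional real inner product space, `S ∈ 𝓢(V, ℂ)`, `a b c ∈ V`, and
`g = ∂ₐ∂_b∂_c S`. This file proves that the multiplier `𝓕 g(ξ)/((2π)²‖ξ‖²)` is integrable and
that its inverse Fourier transform is **integrable and continuous** on `V`
(`integrable_fourierInv_fourier_lineDeriv₃_div_normSq`), through the heat-semigroup
subordination `((2π)²‖ξ‖²)⁻¹ = ∫₀^∞ e^{-(2π)²t‖ξ‖²} dt` (Stein, *Singular integrals*, Ch. III
§1.3, `∂ⱼ∂ₖΔ⁻¹` through the Gauss–Weierstrass semigroup of §2):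

* `fourierInv_fourier_div_normSq_eq_integral_heatExtension` — for `g ∈ L¹ ∩ C⁰` with
  `𝓕 g ∈ L¹` and `𝓕 g/((2π)²‖ξ‖²) ∈ L¹`,
  `𝓕⁻[𝓕 g/((2π)²‖·‖²)](x) = ∫₀^∞ (e^{tΔ} g)(x) dt` (Fubini, the tree's
  `heatExtension_fourier_eq` and Fourier inversion);
* `integrable_integral_Ioi_heatExtension` — if moreover `‖e^{tΔ}g‖₁ ≤ C t^{-3/2}` for `t ≥ 1`,
  then `x ↦ ∫₀^∞ (e^{tΔ} g)(x) dt` is integrable (Tonelli; `‖e^{tΔ}g‖₁ ≤ ‖g‖₁` on `(0,1]`);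
* `eLpNorm_heatExtension_lineDeriv₃_le` — **`‖e^{3sΔ}(∂ₐ∂_b∂_c S)‖₁ ≤ (2^{d/2}s^{-1/2})³
  ‖a‖‖b‖‖c‖ ‖S‖₁`**: each derivative falls on one factor `e^{sΔ}` of the semigroup (the tree's
  `fderiv_heatExtension_apply_eq_heatExtension_fderiv`, `heatExtension_add_holds`) and costs
  `2^{d/2}s^{-1/2}` in `L¹` (the tree's Young bound `eLpNorm_fderiv_heatExtension_apply_le`);
* `norm_fourier_lineDeriv₃_le`, `integrable_fourier_lineDeriv₃_div_normSq` — the multiplier is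
  `O(‖ξ‖ |Ŝ(ξ)|)`, hence integrable;
* `integrable_fourierInv_fourier_sum_lineDeriv₃_div_normSq` — the same for finite sums
  `g = ∑ₘ ∂_{aₘ}∂_{bₘ}∂_{cₘ} Sₘ` (linearity, `fourierInv_finset_sum`), the form met by the Leray
  projection of `div div T` for a Schwartz tensor `T`.

## Mathlib / tree search

Mathlib: `SchwartzMap.fourier_lineDerivOp_eq` (`𝓕(∂ₘ f) = 2πi⟪·,m⟫ 𝓕 f`),
`Continuous.fourierInv_fourier_eq`, `Real.fourierInv_eq_fourier_comp_neg`,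
`integral_exp_mul_Ioi`, `integrable_prod_iff`, `Integrable.integral_prod_right`,
`integral_integral_swap`, `integrableOn_Ioi_rpow_of_lt`. Tree (all proved):
`heatExtension_fourier_eq` (`UnboundedOperators/CaloricFourierSynthesis`),
`eLpNorm_fderiv_heatExtension_apply_le`, `fderiv_heatExtension_apply_eq_heatExtension_fderiv`,
`continuousOn_uncurry_heatExtension_of_memLp` (`UnboundedOperators/HeatFlowCalculus`),
`heatExtension_add_holds`, `eLpNorm_heatExtension_le_holds`, `memLp_heatExtension_holds`
(`UnboundedOperators/HeatKernel`). Nothing in Mathlib or the tree on kernels of homogeneous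
multipliers / Riesz transforms of Schwartz functions in `L¹`
(`lean search 'normSq.*fourier|Riesz.*integrable|div_norm_sq'`).

## References

* E. M. Stein, *Singular integrals and differentiability properties of functions*, Princeton
  (1970), Ch. III §1.3 (Riesz transforms and `∂ⱼ∂ₖΔ⁻¹`), §2 (the Gauss–Weierstrass semigroup
  as the multiplier `e^{-4π²t|ξ|²}`). [`SteinSingularIntegrals1970`]
* T. Tao, J. Amer. Math. Soc. 29 (2016), 601–674 = arXiv:1402.0290v3, §1.1 (consumer). [`Tao2016`]
-/

noncomputable section

open MeasureTheory Filter Topology Set Complex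
open scoped Real ENNReal NNReal FourierTransform RealInnerProductSpace SchwartzMap LineDeriv

namespace Literature.Analysis.FluidPDE

open Literature.Analysis.UnboundedOperators

variable {V : Type*} [NormedAddCommGroup V] [InnerProductSpace ℝ V] [FiniteDimensional ℝ V]
  [MeasurableSpace V] [BorelSpace V]

/-! ### Heat flow of derivatives of Schwartz functions: `L¹` decay -/

section HeatDecay

/-- **The derivative falls on Schwartz data**: `e^{sΔ}(∂ₐφ)(x) = ∂ₐ(e^{sΔ}φ)(x)` for
`φ ∈ 𝓢(V, ℂ)`, `0 < s` (the tree's `fderiv_heatExtension_apply_eq_heatExtension_fderiv` with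
`p = q = 1`). [folklore] -/
theorem heatExtension_lineDeriv_apply (φ : 𝓢(V, ℂ)) (a : V) {s : ℝ} (hs : 0 < s) (x : V) :
    heatExtension (⇑(∂_{a} φ : 𝓢(V, ℂ))) s x = fderiv ℝ (heatExtension (⇑φ) s) x a := by
  have h1 : (⇑(∂_{a} φ : 𝓢(V, ℂ)) : V → ℂ) = fun z => fderiv ℝ (⇑φ) z a :=
    funext fun z => SchwartzMap.lineDerivOp_apply_eq_fderiv a φ z
  have hq : MemLp (fun z => fderiv ℝ (⇑φ) z a) 1 (volume : Measure V) := h1 ▸ (∂_{a} φ : 𝓢(V, ℂ)).memLp 1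
  rw [h1]
  exact (fderiv_heatExtension_apply_eq_heatExtension_fderiv (φ.smooth 1) (φ.memLp 1) le_rfl hq
    le_rfl hs x).symm

/-- **One derivative costs `2^{d/2} s^{-1/2}` in `L¹`**:
`‖e^{sΔ}(∂ₐφ)‖₁ ≤ 2^{d/2} s^{-1/2} ‖a‖ ‖φ‖₁` for `φ ∈ 𝓢(V, ℂ)`, `0 < s`
(Giga–Giga–Saal 2010, §1.1.3, through the tree's Young bound). [folklore] -/
theorem eLpNorm_heatExtension_lineDeriv_le (φ : 𝓢(V, ℂ)) (a : V) {s : ℝ} (hs : 0 < s) :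
    eLpNorm (heatExtension (⇑(∂_{a} φ : 𝓢(V, ℂ))) s) 1 volume ≤
      ENNReal.ofReal ((2 : ℝ) ^ ((Module.finrank ℝ V : ℝ) / 2) * s ^ (-(1 / 2 : ℝ)) * ‖a‖) *
        eLpNorm (⇑φ) 1 volume := by
  have h : heatExtension (⇑(∂_{a} φ : 𝓢(V, ℂ))) s = fun x => fderiv ℝ (heatExtension (⇑φ) s) x a :=
    funext fun x => heatExtension_lineDeriv_apply φ a hs x
  rw [h]
  exact eLpNorm_fderiv_heatExtension_apply_le (φ.memLp 1) le_rfl hs a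

/-- **One derivative on the last factor of the semigroup**:
`‖e^{(t+s)Δ}(∂ₐφ)‖₁ ≤ 2^{d/2} s^{-1/2} ‖a‖ ‖e^{tΔ}φ‖₁` for `φ ∈ 𝓢(V, ℂ)`, `0 < s, t`
(`e^{(t+s)Δ}∂ₐφ = ∂ₐ e^{sΔ}(e^{tΔ}φ)`, semigroup law and the Young bound). [folklore] -/
theorem eLpNorm_heatExtension_add_lineDeriv_le (φ : 𝓢(V, ℂ)) (a : V) {s t : ℝ} (hs : 0 < s)
    (ht : 0 < t) :
    eLpNorm (heatExtension (⇑(∂_{a} φ : 𝓢(V, ℂ))) (t + s)) 1 volume ≤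
      ENNReal.ofReal ((2 : ℝ) ^ ((Module.finrank ℝ V : ℝ) / 2) * s ^ (-(1 / 2 : ℝ)) * ‖a‖) *
        eLpNorm (heatExtension (⇑φ) t) 1 volume := by
  have hψ : MemLp (heatExtension (⇑φ) t) 1 (volume : Measure V) :=
    memLp_heatExtension_holds (φ.memLp 1) le_rfl ht
  have h : heatExtension (⇑(∂_{a} φ : 𝓢(V, ℂ))) (t + s) =
      fun x => fderiv ℝ (heatExtension (heatExtension (⇑φ) t) s) x a := by
    funext x
    rw [heatExtension_lineDeriv_apply φ a (by positivity) x,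
      heatExtension_add_holds (φ.memLp 1) le_rfl ht hs]
  rw [h]
  exact eLpNorm_fderiv_heatExtension_apply_le hψ le_rfl hs a

/-- **Three derivatives cost `(2^{d/2}s^{-1/2})³` in `L¹`**: for `S ∈ 𝓢(V, ℂ)`, `a b c ∈ V` and
`0 < s`,
`‖e^{3sΔ}(∂ₐ∂_b∂_c S)‖₁ ≤ (2^{d/2}s^{-1/2}‖a‖)(2^{d/2}s^{-1/2}‖b‖)(2^{d/2}s^{-1/2}‖c‖) ‖S‖₁`
(Giga–Giga–Saal 2010, §1.1.3: `‖∂^α e^{tΔ} f‖₁ ≤ C t^{-|α|/2} ‖f‖₁`; here one derivative per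
factor of `e^{sΔ}e^{sΔ}e^{sΔ}`). [folklore] -/
theorem eLpNorm_heatExtension_lineDeriv₃_le (S : 𝓢(V, ℂ)) (a b c : V) {s : ℝ} (hs : 0 < s) :
    eLpNorm (heatExtension (⇑(∂_{a} (∂_{b} (∂_{c} S)) : 𝓢(V, ℂ))) (s + s + s)) 1 volume ≤
      ENNReal.ofReal ((2 : ℝ) ^ ((Module.finrank ℝ V : ℝ) / 2) * s ^ (-(1 / 2 : ℝ)) * ‖a‖) *
      ENNReal.ofReal ((2 : ℝ) ^ ((Module.finrank ℝ V : ℝ) / 2) * s ^ (-(1 / 2 : ℝ)) * ‖b‖) *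
      ENNReal.ofReal ((2 : ℝ) ^ ((Module.finrank ℝ V : ℝ) / 2) * s ^ (-(1 / 2 : ℝ)) * ‖c‖) *
        eLpNorm (⇑S) 1 volume := by
  calc eLpNorm (heatExtension (⇑(∂_{a} (∂_{b} (∂_{c} S)) : 𝓢(V, ℂ))) (s + s + s)) 1 volume
      ≤ ENNReal.ofReal ((2 : ℝ) ^ ((Module.finrank ℝ V : ℝ) / 2) * s ^ (-(1 / 2 : ℝ)) * ‖a‖) *
          eLpNorm (heatExtension (⇑(∂_{b} (∂_{c} S) : 𝓢(V, ℂ))) (s + s)) 1 volume :=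
        eLpNorm_heatExtension_add_lineDeriv_le _ a hs (by positivity)
    _ ≤ ENNReal.ofReal ((2 : ℝ) ^ ((Module.finrank ℝ V : ℝ) / 2) * s ^ (-(1 / 2 : ℝ)) * ‖a‖) *
          (ENNReal.ofReal ((2 : ℝ) ^ ((Module.finrank ℝ V : ℝ) / 2) * s ^ (-(1 / 2 : ℝ)) * ‖b‖) *
            eLpNorm (heatExtension (⇑(∂_{c} S : 𝓢(V, ℂ))) s) 1 volume) :=
        mul_le_mul' le_rfl (eLpNorm_heatExtension_add_lineDeriv_le _ b hs hs)
    _ ≤ ENNReal.ofReal ((2 : ℝ) ^ ((Module.finrank ℝ V : ℝ) / 2) * s ^ (-(1 / 2 : ℝ)) * ‖a‖) *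
          (ENNReal.ofReal ((2 : ℝ) ^ ((Module.finrank ℝ V : ℝ) / 2) * s ^ (-(1 / 2 : ℝ)) * ‖b‖) *
            (ENNReal.ofReal ((2 : ℝ) ^ ((Module.finrank ℝ V : ℝ) / 2) * s ^ (-(1 / 2 : ℝ)) * ‖c‖) *
              eLpNorm (⇑S) 1 volume)) :=
        mul_le_mul' le_rfl (mul_le_mul' le_rfl (eLpNorm_heatExtension_lineDeriv_le S c hs))
    _ = _ := by ring

/-- The `L¹` decay in the form used below: for `t ≥ 1`,
`‖e^{tΔ}(∂ₐ∂_b∂_c S)‖₁ ≤ C t^{-3/2}` with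
`C = 2^{3d/2} 3^{3/2} ‖a‖‖b‖‖c‖ ‖S‖₁`. [folklore] -/
theorem eLpNorm_heatExtension_lineDeriv₃_le_rpow (S : 𝓢(V, ℂ)) (a b c : V) :
    ∃ C : ℝ, 0 ≤ C ∧ ∀ t : ℝ, 1 ≤ t →
      eLpNorm (heatExtension (⇑(∂_{a} (∂_{b} (∂_{c} S)) : 𝓢(V, ℂ))) t) 1 volume ≤
        ENNReal.ofReal (C * t ^ (-(3 / 2 : ℝ))) := by
  set K : ℝ := (2 : ℝ) ^ ((Module.finrank ℝ V : ℝ) / 2) with hK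
  have hK0 : 0 ≤ K := by positivity
  have hS : eLpNorm (⇑S) 1 volume < ∞ := (S.memLp 1 (μ := (volume : Measure V))).eLpNorm_lt_top
  refine ⟨K ^ 3 * (3 : ℝ) ^ (3 / 2 : ℝ) * ‖a‖ * ‖b‖ * ‖c‖ * (eLpNorm (⇑S) 1 volume).toReal,
    by positivity, fun t ht => ?_⟩
  have ht0 : 0 < t := by linarith
  have hs : 0 < t / 3 := by positivity
  have h := eLpNorm_heatExtension_lineDeriv₃_le S a b c hs
  have h3 : t / 3 + t / 3 + t / 3 = t := by ring
  rw [h3] at h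
  refine h.trans (le_of_eq ?_)
  rw [← ENNReal.ofReal_toReal hS.ne, ← ENNReal.ofReal_mul (by positivity),
    ← ENNReal.ofReal_mul (by positivity), ← ENNReal.ofReal_mul (by positivity)]
  congr 1
  rw [ENNReal.toReal_ofReal ENNReal.toReal_nonneg]
  have hpow : (t / 3) ^ (-(1 / 2 : ℝ)) * (t / 3) ^ (-(1 / 2 : ℝ)) * (t / 3) ^ (-(1 / 2 : ℝ)) =
      (3 : ℝ) ^ (3 / 2 : ℝ) * t ^ (-(3 / 2 : ℝ)) := by
    rw [← Real.rpow_add hs, ← Real.rpow_add hs, Real.div_rpow ht0.le (by norm_num),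
      div_eq_mul_inv, ← Real.rpow_neg (by norm_num)]
    norm_num
    ring
  calc K * (t / 3) ^ (-(1 / 2 : ℝ)) * ‖a‖ * (K * (t / 3) ^ (-(1 / 2 : ℝ)) * ‖b‖) *
        (K * (t / 3) ^ (-(1 / 2 : ℝ)) * ‖c‖) * (eLpNorm (⇑S) 1 volume).toReal
      = K ^ 3 * ((t / 3) ^ (-(1 / 2 : ℝ)) * (t / 3) ^ (-(1 / 2 : ℝ)) * (t / 3) ^ (-(1 / 2 : ℝ))) *
          ‖a‖ * ‖b‖ * ‖c‖ * (eLpNorm (⇑S) 1 volume).toReal := by ring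
    _ = _ := by rw [hpow]; ring

end HeatDecay

/-! ### The heat symbol: subordination `((2π)²‖ξ‖²)⁻¹ = ∫₀^∞ e^{-(2π)²t‖ξ‖²} dt` -/

section Symbol

omit [InnerProductSpace ℝ V] [FiniteDimensional ℝ V] [MeasurableSpace V] [BorelSpace V] in
/-- The heat symbol as an exponential in time: `e^{-(2π)²t‖ξ‖²} = exp (-((2π)²‖ξ‖²) t)`.
[folklore] -/
theorem heatSymbol_eq_exp_mul (t : ℝ) (ξ : V) :
    heatSymbol t ξ = Real.exp (-((2 * π) ^ 2 * ‖ξ‖ ^ 2) * t) := by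
  unfold heatSymbol
  congr 1
  ring

omit [InnerProductSpace ℝ V] [FiniteDimensional ℝ V] [MeasurableSpace V] [BorelSpace V] in
/-- **Subordination**: `∫₀^∞ e^{-(2π)²t‖ξ‖²} dt = ((2π)²‖ξ‖²)⁻¹` for `ξ ≠ 0` (Stein 1970,
Ch. III §1.3/§2: `-Δ⁻¹ = ∫₀^∞ e^{tΔ} dt` on the Fourier side). [folklore] -/
theorem heatSymbol_integral_Ioi_zero {ξ : V} (hξ : ξ ≠ 0) :
    ∫ t in Ioi (0 : ℝ), heatSymbol t ξ = 1 / ((2 * π) ^ 2 * ‖ξ‖ ^ 2) := by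
  have hpos : 0 < (2 * π) ^ 2 * ‖ξ‖ ^ 2 := by
    have := norm_pos_iff.2 hξ
    positivity
  simp_rw [heatSymbol_eq_exp_mul]
  rw [integral_exp_mul_Ioi (by linarith) 0]
  simp only [mul_zero, Real.exp_zero]
  field_simp

omit [InnerProductSpace ℝ V] [FiniteDimensional ℝ V] [MeasurableSpace V] [BorelSpace V] in
/-- `t ↦ e^{-(2π)²t‖ξ‖²}` is integrable on `(0, ∞)` for `ξ ≠ 0`. [folklore] -/
theorem heatSymbol_integrableOn_Ioi_zero {ξ : V} (hξ : ξ ≠ 0) :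
    IntegrableOn (fun t : ℝ => heatSymbol t ξ) (Ioi 0) := by
  have hpos : 0 < (2 * π) ^ 2 * ‖ξ‖ ^ 2 := by
    have := norm_pos_iff.2 hξ
    positivity
  have h := exp_neg_integrableOn_Ioi 0 hpos
  refine h.congr_fun (fun t _ => ?_) measurableSet_Ioi
  simp only [heatSymbol_eq_exp_mul, neg_mul]

omit [InnerProductSpace ℝ V] [FiniteDimensional ℝ V] [MeasurableSpace V] [BorelSpace V] in
/-- The heat symbol is jointly continuous in `(t, ξ)`. [folklore] -/
theorem continuous_uncurry_heatSymbol : Continuous fun p : ℝ × V => heatSymbol p.1 p.2 := by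
  unfold heatSymbol
  fun_prop

omit [InnerProductSpace ℝ V] [FiniteDimensional ℝ V] [MeasurableSpace V] [BorelSpace V] in
/-- The heat symbol is even in `ξ`. [folklore] -/
theorem heatSymbol_even (t : ℝ) (ξ : V) : heatSymbol t (-ξ) = heatSymbol t ξ := by
  simp [heatSymbol, norm_neg]

end Symbol

/-! ### The representation `𝓕⁻[𝓕 g/((2π)²‖·‖²)] = ∫₀^∞ e^{tΔ} g dt` -/

section Representation

/-- **The heat flow on the Fourier side**: for `g ∈ L¹ ∩ C⁰` with `𝓕 g ∈ L¹` and `0 < t`,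
`𝓕⁻[e^{-(2π)²t‖·‖²} 𝓕 g](x) = (e^{tΔ} g)(x)` (the tree's `heatExtension_fourier_eq` applied to
`m = 𝓕 g (-·)`, whose synthesis `𝓕 m = 𝓕⁻𝓕 g` is `g` by Fourier inversion). Stein 1970,
Ch. III §2. [folklore] -/
theorem fourierInv_heatSymbol_mul_fourier_eq_heatExtension {g : V → ℂ} (hgc : Continuous g)
    (hgi : Integrable g) (hFg : Integrable (𝓕 g)) {t : ℝ} (ht : 0 < t) (x : V) :
    𝓕⁻ (fun ξ : V => ((heatSymbol t ξ : ℝ) : ℂ) * 𝓕 g ξ) x = heatExtension g t x := by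
  have hm : Integrable (fun ξ : V => 𝓕 g (-ξ)) := hFg.comp_neg
  have hsynth : 𝓕 (fun ξ : V => 𝓕 g (-ξ)) = g := by
    rw [← Real.fourierInv_eq_fourier_comp_neg]
    exact hgc.fourierInv_fourier_eq hgi hFg
  have h := heatExtension_fourier_eq hm ht x
  rw [hsynth] at h
  rw [h, Real.fourierInv_eq_fourier_comp_neg]
  simp_rw [heatSymbol_even]

variable [Nontrivial V]

/-- **Heat-semigroup subordination of the multiplier `((2π)²‖ξ‖²)⁻¹`**: for `g ∈ L¹ ∩ C⁰` with
`𝓕 g ∈ L¹` and `𝓕 g/((2π)²‖·‖²) ∈ L¹`, and every `x`,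
`𝓕⁻[𝓕 g/((2π)²‖·‖²)](x) = ∫₀^∞ (e^{tΔ} g)(x) dt`
(Fubini in `(ξ, t)`: the integrand `e^{2πi⟪ξ,x⟫} e^{-(2π)²t‖ξ‖²} 𝓕 g(ξ)` has
`∫∫ |·| = ∫ |𝓕 g|/((2π)²‖ξ‖²) < ∞`). Stein 1970, Ch. III §1.3 (`∂ⱼ∂ₖΔ⁻¹f = -∫₀^∞ ∂ⱼ∂ₖ e^{tΔ}f dt`).
[folklore] -/
theorem fourierInv_fourier_div_normSq_eq_integral_heatExtension {g : V → ℂ} (hgc : Continuous g)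
    (hgi : Integrable g) (hFg : Integrable (𝓕 g))
    (hq : Integrable (fun ξ : V => 𝓕 g ξ / (((2 * π) ^ 2 * ‖ξ‖ ^ 2 : ℝ) : ℂ))) (x : V) :
    𝓕⁻ (fun ξ : V => 𝓕 g ξ / (((2 * π) ^ 2 * ‖ξ‖ ^ 2 : ℝ) : ℂ)) x =
      ∫ t in Ioi (0 : ℝ), heatExtension g t x := by
  have hFc : Continuous (𝓕 g) := Literature.Analysis.FunctionSpaces.continuous_fourierIntegral hgi
  -- the two-variable integrand
  set I : V → ℝ → ℂ := fun ξ t => heatSymbol t ξ • (((𝐞 ⟪ξ, x⟫ : Circle) : ℂ) * 𝓕 g ξ) with hI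
  have hae : ∀ᵐ ξ : V ∂volume, ξ ≠ 0 := compl_mem_ae_iff.mpr (measure_singleton (0 : V))
  -- Step 1: pointwise subordination of the integrand
  have hpt : ∀ ξ : V, ξ ≠ 0 →
      (𝐞 ⟪ξ, x⟫ : Circle) • (𝓕 g ξ / (((2 * π) ^ 2 * ‖ξ‖ ^ 2 : ℝ) : ℂ)) =
        ∫ t in Ioi (0 : ℝ), I ξ t := by
    intro ξ hξ
    have hpos : 0 < (2 * π) ^ 2 * ‖ξ‖ ^ 2 := by
      have := norm_pos_iff.2 hξ
      positivity
    simp only [hI]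
    rw [integral_smul_const, heatSymbol_integral_Ioi_zero hξ, Circle.smul_def, smul_eq_mul,
      Complex.real_smul, Complex.ofReal_div, Complex.ofReal_one]
    have hne : (((2 * π) ^ 2 * ‖ξ‖ ^ 2 : ℝ) : ℂ) ≠ 0 := Complex.ofReal_ne_zero.2 hpos.ne'
    field_simp
  -- Step 2: norms of the integrand
  have hnorm : ∀ (ξ : V) (t : ℝ), ‖I ξ t‖ = heatSymbol t ξ * ‖𝓕 g ξ‖ := by
    intro ξ t
    simp only [hI, norm_smul, norm_mul, Circle.norm_coe, one_mul,
      Real.norm_of_nonneg (heatSymbol_pos t ξ).le]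
  -- Step 3: integrability on the product
  have hmeas : AEStronglyMeasurable (Function.uncurry I)
      ((volume : Measure V).prod (volume.restrict (Ioi (0 : ℝ)))) := by
    refine Continuous.aestronglyMeasurable ?_
    have h1 : Continuous fun p : V × ℝ => heatSymbol p.2 p.1 :=
      continuous_uncurry_heatSymbol.comp (continuous_snd.prodMk continuous_fst)
    have h2 : Continuous fun p : V × ℝ => (((𝐞 ⟪p.1, x⟫ : Circle) : ℂ)) :=
      continuous_subtype_val.comp
        (Real.continuous_fourierChar.comp (continuous_fst.inner continuous_const))
    have h3 : Continuous fun p : V × ℝ => 𝓕 g p.1 := hFc.comp continuous_fst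
    exact h1.smul (h2.mul h3)
  have hint : Integrable (Function.uncurry I)
      ((volume : Measure V).prod (volume.restrict (Ioi (0 : ℝ)))) := by
    refine (integrable_prod_iff hmeas).2 ⟨?_, ?_⟩
    · filter_upwards [hae] with ξ hξ
      change Integrable (fun t => I ξ t) (volume.restrict (Ioi 0))
      simp only [hI]
      exact (heatSymbol_integrableOn_Ioi_zero hξ).smul_const _
    · have heq : (fun ξ : V => ∫ t, ‖Function.uncurry I (ξ, t)‖ ∂(volume.restrict (Ioi 0))) =ᵐ[volume]
          fun ξ => ‖𝓕 g ξ / (((2 * π) ^ 2 * ‖ξ‖ ^ 2 : ℝ) : ℂ)‖ := by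
        filter_upwards [hae] with ξ hξ
        have hpos : 0 < (2 * π) ^ 2 * ‖ξ‖ ^ 2 := by
          have := norm_pos_iff.2 hξ
          positivity
        simp only [Function.uncurry_apply_pair, hnorm]
        rw [integral_mul_const, heatSymbol_integral_Ioi_zero hξ, norm_div, Complex.norm_real,
          Real.norm_of_nonneg hpos.le]
        field_simp
      exact hq.norm.congr heq.symm
  -- Step 4: assemble
  rw [Real.fourierInv_eq]
  calc ∫ ξ : V, (𝐞 ⟪ξ, x⟫ : Circle) • (𝓕 g ξ / (((2 * π) ^ 2 * ‖ξ‖ ^ 2 : ℝ) : ℂ))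
      = ∫ ξ : V, ∫ t in Ioi (0 : ℝ), I ξ t := by
        refine integral_congr_ae ?_
        filter_upwards [hae] with ξ hξ
        exact hpt ξ hξ
    _ = ∫ t in Ioi (0 : ℝ), ∫ ξ : V, I ξ t := integral_integral_swap hint
    _ = ∫ t in Ioi (0 : ℝ), heatExtension g t x := by
        refine setIntegral_congr_fun measurableSet_Ioi fun t ht => ?_
        rw [← fourierInv_heatSymbol_mul_fourier_eq_heatExtension hgc hgi hFg ht x,
          Real.fourierInv_eq]
        refine integral_congr_ae (Eventually.of_forall fun ξ => ?_)
        simp only [hI, Circle.smul_def, Complex.real_smul]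
        ring

end Representation

/-! ### Tonelli: `x ↦ ∫₀^∞ e^{tΔ} g (x) dt` is integrable -/

section Tonelli

/-- `∫ ‖e^{tΔ} g‖ = ‖e^{tΔ}g‖₁` as a real number (`t > 0`, `g ∈ L¹`). [folklore] -/
theorem integral_norm_heatExtension_eq_toReal {g : V → ℂ} (hgi : Integrable g) {t : ℝ}
    (ht : 0 < t) :
    ∫ x, ‖heatExtension g t x‖ = (eLpNorm (heatExtension g t) 1 volume).toReal := by
  have hm : MemLp (heatExtension g t) 1 volume :=
    memLp_heatExtension_holds (memLp_one_iff_integrable.2 hgi) le_rfl ht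
  rw [integral_norm_eq_lintegral_enorm hm.1, eLpNorm_one_eq_lintegral_enorm]

/-- **Tonelli step**: if `g ∈ L¹(V)` and `‖e^{tΔ} g‖₁ ≤ C t^{-3/2}` for `t ≥ 1`, then
`x ↦ ∫₀^∞ (e^{tΔ} g)(x) dt` is integrable on `V`, since
`∫∫ |e^{tΔ}g(x)| dx dt ≤ ∫₀¹ ‖g‖₁ dt + ∫₁^∞ C t^{-3/2} dt < ∞` (joint measurability from the
tree's `continuousOn_uncurry_heatExtension_of_memLp`). [folklore] -/
theorem integrable_integral_Ioi_heatExtension {g : V → ℂ} (hgi : Integrable g) {C : ℝ}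
    (hC : 0 ≤ C)
    (hdec : ∀ t : ℝ, 1 ≤ t →
      eLpNorm (heatExtension g t) 1 volume ≤ ENNReal.ofReal (C * t ^ (-(3 / 2 : ℝ)))) :
    Integrable (fun x : V => ∫ t in Ioi (0 : ℝ), heatExtension g t x) := by
  have hg1 : MemLp g 1 (volume : Measure V) := memLp_one_iff_integrable.2 hgi
  set Φ : ℝ × V → ℂ := fun p => heatExtension g p.1 p.2 with hΦ
  -- joint measurability on `(0, ∞) × V`
  have hμ : ((volume : Measure ℝ).restrict (Ioi 0)).prod (volume : Measure V) =
      ((volume : Measure ℝ).prod (volume : Measure V)).restrict (Ioi 0 ×ˢ univ) := by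
    rw [← Measure.prod_restrict, Measure.restrict_univ]
  have hmeasΦ : AEStronglyMeasurable Φ
      (((volume : Measure ℝ).restrict (Ioi 0)).prod (volume : Measure V)) := by
    rw [hμ]
    exact (continuousOn_uncurry_heatExtension_of_memLp hg1 le_rfl).aestronglyMeasurable
      (measurableSet_Ioi.prod MeasurableSet.univ)
  -- the slices are integrable
  have hslice : ∀ᵐ t : ℝ ∂(volume.restrict (Ioi 0)), Integrable (fun x : V => Φ (t, x)) volume := by
    rw [ae_restrict_iff' measurableSet_Ioi]
    exact Eventually.of_forall fun t (ht : 0 < t) =>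
      memLp_one_iff_integrable.1 (memLp_heatExtension_holds hg1 le_rfl ht)
  -- the `L¹` norms are integrable in time
  set N : ℝ → ℝ := fun t => ∫ x : V, ‖Φ (t, x)‖ with hN
  have hNmeas : AEStronglyMeasurable N (volume.restrict (Ioi 0)) := hmeasΦ.norm.integral_prod_right'
  have hN_eq : ∀ t : ℝ, 0 < t → N t = (eLpNorm (heatExtension g t) 1 volume).toReal :=
    fun t ht => integral_norm_heatExtension_eq_toReal hgi ht
  have hN_nonneg : ∀ t, 0 ≤ N t := fun t => integral_nonneg fun x => norm_nonneg _
  have hN1 : IntegrableOn N (Ioc 0 1) := by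
    refine Integrable.mono' (g := fun _ => (eLpNorm g 1 volume).toReal)
      (integrableOn_const (by simp)) (hNmeas.mono_measure
        (Measure.restrict_mono Ioc_subset_Ioi_self le_rfl)) ?_
    rw [ae_restrict_iff' measurableSet_Ioc]
    refine Eventually.of_forall fun t ht => ?_
    rw [Real.norm_of_nonneg (hN_nonneg t), hN_eq t ht.1]
    exact ENNReal.toReal_mono hg1.eLpNorm_lt_top.ne (eLpNorm_heatExtension_le_holds hg1 le_rfl ht.1)
  have hN2 : IntegrableOn N (Ioi 1) := by
    refine Integrable.mono' (g := fun t => C * t ^ (-(3 / 2 : ℝ)))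
      ((integrableOn_Ioi_rpow_of_lt (by norm_num) one_pos).const_mul C)
      (hNmeas.mono_measure (Measure.restrict_mono (Ioi_subset_Ioi zero_le_one) le_rfl)) ?_
    rw [ae_restrict_iff' measurableSet_Ioi]
    refine Eventually.of_forall fun t (ht : 1 < t) => ?_
    have ht0 : 0 < t := by linarith
    rw [Real.norm_of_nonneg (hN_nonneg t), hN_eq t ht0]
    have h := ENNReal.toReal_mono ENNReal.ofReal_ne_top (hdec t ht.le)
    rwa [ENNReal.toReal_ofReal (by positivity)] at h
  have hNint : Integrable N (volume.restrict (Ioi 0)) := by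
    have h := hN1.union hN2
    rwa [Ioc_union_Ioi_eq_Ioi zero_le_one] at h
  have hInt : Integrable Φ (((volume : Measure ℝ).restrict (Ioi 0)).prod (volume : Measure V)) :=
    (integrable_prod_iff hmeasΦ).2 ⟨hslice, hNint⟩
  exact hInt.integral_prod_right

end Tonelli

/-! ### The multiplier `𝓕(∂ₐ∂_b∂_c S)/((2π)²‖ξ‖²)` and the main theorem -/

section Multiplier

/-- **Fourier transform of a line derivative**, pointwise:
`𝓕(∂ₘ f)(ξ) = 2πi ⟪ξ, m⟫ 𝓕 f(ξ)` (Mathlib's `SchwartzMap.fourier_lineDerivOp_eq`). [folklore] -/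
theorem fourier_lineDeriv_apply (f : 𝓢(V, ℂ)) (m ξ : V) :
    𝓕 (⇑(∂_{m} f : 𝓢(V, ℂ))) ξ = 2 * π * I * ⟪ξ, m⟫ * 𝓕 (⇑f) ξ := by
  have hg : Function.HasTemperateGrowth (fun x : V => ⟪x, m⟫) := by fun_prop
  rw [← SchwartzMap.fourier_coe, SchwartzMap.fourier_lineDerivOp_eq f m, smul_apply,
    SchwartzMap.smulLeftCLM_apply_apply hg, SchwartzMap.fourier_coe, Complex.real_smul, smul_eq_mul]
  ring

/-- `𝓕(∂ₐ∂_b∂_c S)(ξ) = (2πi)³ ⟪ξ,a⟫⟪ξ,b⟫⟪ξ,c⟫ 𝓕 S(ξ)`. [folklore] -/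
theorem fourier_lineDeriv₃_apply (S : 𝓢(V, ℂ)) (a b c ξ : V) :
    𝓕 (⇑(∂_{a} (∂_{b} (∂_{c} S)) : 𝓢(V, ℂ))) ξ =
      (2 * π * I) ^ 3 * ⟪ξ, a⟫ * ⟪ξ, b⟫ * ⟪ξ, c⟫ * 𝓕 (⇑S) ξ := by
  rw [fourier_lineDeriv_apply, fourier_lineDeriv_apply, fourier_lineDeriv_apply]
  ring

/-- **The symbol vanishes to third order at the origin**:
`|𝓕(∂ₐ∂_b∂_c S)(ξ)| ≤ (2π)³ ‖a‖‖b‖‖c‖ ‖ξ‖³ |𝓕 S(ξ)|`. [folklore] -/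
theorem norm_fourier_lineDeriv₃_le (S : 𝓢(V, ℂ)) (a b c ξ : V) :
    ‖𝓕 (⇑(∂_{a} (∂_{b} (∂_{c} S)) : 𝓢(V, ℂ))) ξ‖ ≤
      (2 * π) ^ 3 * (‖a‖ * ‖b‖ * ‖c‖) * ‖ξ‖ ^ 3 * ‖𝓕 (⇑S) ξ‖ := by
  rw [fourier_lineDeriv₃_apply]
  have h2 : ‖(2 * π * I : ℂ)‖ = 2 * π := by
    simp [Complex.norm_real, Real.pi_pos.le]
  have ha : ‖(⟪ξ, a⟫ : ℂ)‖ ≤ ‖ξ‖ * ‖a‖ := by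
    rw [Complex.norm_real]; exact (abs_real_inner_le_norm ξ a)
  have hb : ‖(⟪ξ, b⟫ : ℂ)‖ ≤ ‖ξ‖ * ‖b‖ := by
    rw [Complex.norm_real]; exact (abs_real_inner_le_norm ξ b)
  have hc : ‖(⟪ξ, c⟫ : ℂ)‖ ≤ ‖ξ‖ * ‖c‖ := by
    rw [Complex.norm_real]; exact (abs_real_inner_le_norm ξ c)
  calc ‖(2 * π * I) ^ 3 * (⟪ξ, a⟫ : ℂ) * (⟪ξ, b⟫ : ℂ) * (⟪ξ, c⟫ : ℂ) * 𝓕 (⇑S) ξ‖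
      = (2 * π) ^ 3 * ‖(⟪ξ, a⟫ : ℂ)‖ * ‖(⟪ξ, b⟫ : ℂ)‖ * ‖(⟪ξ, c⟫ : ℂ)‖ * ‖𝓕 (⇑S) ξ‖ := by
        simp only [norm_mul, norm_pow, h2]
    _ ≤ (2 * π) ^ 3 * (‖ξ‖ * ‖a‖) * (‖ξ‖ * ‖b‖) * (‖ξ‖ * ‖c‖) * ‖𝓕 (⇑S) ξ‖ := by
        gcongr
    _ = _ := by ring

/-- **The multiplier `𝓕(∂ₐ∂_b∂_c S)(ξ)/((2π)²‖ξ‖²)` is integrable**: it is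
`O(2π‖a‖‖b‖‖c‖ ‖ξ‖ |𝓕 S(ξ)|)` with `𝓕 S` Schwartz. [folklore] -/
theorem integrable_fourier_lineDeriv₃_div_normSq (S : 𝓢(V, ℂ)) (a b c : V) :
    Integrable (fun ξ : V => 𝓕 (⇑(∂_{a} (∂_{b} (∂_{c} S)) : 𝓢(V, ℂ))) ξ /
      (((2 * π) ^ 2 * ‖ξ‖ ^ 2 : ℝ) : ℂ)) := by
  set G : 𝓢(V, ℂ) := ∂_{a} (∂_{b} (∂_{c} S)) with hG
  have hc : Continuous (𝓕 (⇑G)) := by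
    rw [← SchwartzMap.fourier_coe]; exact SchwartzMap.continuous _
  have hd : Continuous fun ξ : V => (((2 * π) ^ 2 * ‖ξ‖ ^ 2 : ℝ) : ℂ) := by fun_prop
  have hmeas : AEStronglyMeasurable
      (fun ξ : V => 𝓕 (⇑G) ξ / (((2 * π) ^ 2 * ‖ξ‖ ^ 2 : ℝ) : ℂ)) volume :=
    (hc.measurable.div hd.measurable).aestronglyMeasurable
  have hdom : Integrable (fun ξ : V => 2 * π * (‖a‖ * ‖b‖ * ‖c‖) * (‖ξ‖ ^ 1 * ‖𝓕 (⇑S) ξ‖)) := by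
    have h := SchwartzMap.integrable_pow_mul (volume : Measure V) (𝓕 S) 1
    exact h.const_mul _
  refine hdom.mono' hmeas (Eventually.of_forall fun ξ => ?_)
  rw [norm_div, Complex.norm_real, Real.norm_of_nonneg (by positivity), pow_one]
  rcases eq_or_ne ξ 0 with hξ | hξ
  · simp [hξ]
  have hpos : 0 < (2 * π) ^ 2 * ‖ξ‖ ^ 2 := by
    have := norm_pos_iff.2 hξ
    positivity
  rw [div_le_iff₀ hpos]
  calc ‖𝓕 (⇑G) ξ‖ ≤ (2 * π) ^ 3 * (‖a‖ * ‖b‖ * ‖c‖) * ‖ξ‖ ^ 3 * ‖𝓕 (⇑S) ξ‖ :=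
        norm_fourier_lineDeriv₃_le S a b c ξ
    _ = 2 * π * (‖a‖ * ‖b‖ * ‖c‖) * (‖ξ‖ * ‖𝓕 (⇑S) ξ‖) * ((2 * π) ^ 2 * ‖ξ‖ ^ 2) := by ring

variable [Nontrivial V]

/-- **Third-order Riesz-type multipliers of Schwartz functions have integrable, continuous
kernels.** For `S ∈ 𝓢(V, ℂ)` and `a b c ∈ V`, the inverse Fourier transform of
`ξ ↦ 𝓕(∂ₐ∂_b∂_c S)(ξ)/((2π)²‖ξ‖²) = -2πi ⟪ξ,a⟫⟪ξ,b⟫⟪ξ,c⟫ 𝓕S(ξ)/‖ξ‖²` is integrable and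
continuous on `V`: it equals `∫₀^∞ e^{tΔ}(∂ₐ∂_b∂_c S) dt`, whose `L¹` norm is at most
`∫₀¹ ‖∂ₐ∂_b∂_c S‖₁ + ∫₁^∞ C t^{-3/2} dt`. (Classically: the kernel of a multiplier homogeneous
of degree `1` and smooth on the sphere is homogeneous of degree `-d-1`, Stein 1970, Ch. III
§3; here via the heat semigroup, Ch. III §1.3, §2.) [folklore] -/
theorem integrable_fourierInv_fourier_lineDeriv₃_div_normSq (S : 𝓢(V, ℂ)) (a b c : V) :
    Integrable (𝓕⁻ fun ξ : V => 𝓕 (⇑(∂_{a} (∂_{b} (∂_{c} S)) : 𝓢(V, ℂ))) ξ /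
      (((2 * π) ^ 2 * ‖ξ‖ ^ 2 : ℝ) : ℂ)) ∧
    Continuous (𝓕⁻ fun ξ : V => 𝓕 (⇑(∂_{a} (∂_{b} (∂_{c} S)) : 𝓢(V, ℂ))) ξ /
      (((2 * π) ^ 2 * ‖ξ‖ ^ 2 : ℝ) : ℂ)) := by
  set G : 𝓢(V, ℂ) := ∂_{a} (∂_{b} (∂_{c} S)) with hG
  have hgc : Continuous (⇑G) := G.continuous
  have hgi : Integrable (⇑G) := G.integrable
  have hFg : Integrable (𝓕 (⇑G)) := by
    rw [← SchwartzMap.fourier_coe]; exact (𝓕 G).integrable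
  have hq := integrable_fourier_lineDeriv₃_div_normSq S a b c
  obtain ⟨C, hC0, hdec⟩ := eLpNorm_heatExtension_lineDeriv₃_le_rpow S a b c
  have hrep : (𝓕⁻ fun ξ : V => 𝓕 (⇑G) ξ / (((2 * π) ^ 2 * ‖ξ‖ ^ 2 : ℝ) : ℂ)) =
      fun x => ∫ t in Ioi (0 : ℝ), heatExtension (⇑G) t x :=
    funext fun x => fourierInv_fourier_div_normSq_eq_integral_heatExtension hgc hgi hFg hq x
  refine ⟨?_, ?_⟩
  · rw [hrep]
    exact integrable_integral_Ioi_heatExtension hgi hC0 hdec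
  · have hL : Continuous fun p : V × V => (-innerₗ V) p.1 p.2 := continuous_inner.neg
    exact VectorFourier.fourierIntegral_continuous Real.continuous_fourierChar hL hq

omit [Nontrivial V] in
/-- **Linearity of `𝓕⁻` over finite sums of integrable functions** (Mathlib's
`VectorFourier.fourierIntegral_add`, iterated). [folklore] -/
theorem fourierInv_finset_sum {E : Type*} [NormedAddCommGroup E] [NormedSpace ℂ E]
    {α : Type*} (s : Finset α) {f : α → V → E} (hf : ∀ m ∈ s, Integrable (f m)) :
    𝓕⁻ (∑ m ∈ s, f m) = ∑ m ∈ s, 𝓕⁻ (f m) := by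
  classical
  have hL : Continuous fun p : V × V => (-innerₗ V) p.1 p.2 := continuous_inner.neg
  induction s using Finset.induction_on with
  | empty =>
    funext x
    simp [Real.fourierInv_eq]
  | insert m s hm ih =>
    rw [Finset.sum_insert hm, Finset.sum_insert hm]
    have h1 : Integrable (f m) := hf m (Finset.mem_insert_self m s)
    have h2 : Integrable (∑ k ∈ s, f k) :=
      integrable_finsetSum' s fun k hk => hf k (Finset.mem_insert_of_mem hk)
    have hadd := VectorFourier.fourierIntegral_add Real.continuous_fourierChar hL h1 h2
    change VectorFourier.fourierIntegral 𝐞 volume (-innerₗ V) (f m + ∑ k ∈ s, f k) = _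
    rw [hadd, ← ih fun k hk => hf k (Finset.mem_insert_of_mem hk)]
    rfl

/-- **Finite sums of third-order Riesz-type multipliers**: for `g = ∑ₘ ∂_{aₘ}∂_{bₘ}∂_{cₘ} Sₘ`
(a finite sum of triple line derivatives of Schwartz functions), the multiplier
`𝓕 g(ξ)/((2π)²‖ξ‖²)` is integrable and its inverse Fourier transform is integrable and
continuous (linearity and `integrable_fourierInv_fourier_lineDeriv₃_div_normSq`). This is the
form consumed by the Leray projection of a divergence `div div T` of a Schwartz tensor.
[folklore] -/
theorem integrable_fourierInv_fourier_sum_lineDeriv₃_div_normSq {α : Type*} (s : Finset α)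
    (S : α → 𝓢(V, ℂ)) (a b c : α → V) (g : 𝓢(V, ℂ))
    (hg : g = ∑ m ∈ s, (∂_{a m} (∂_{b m} (∂_{c m} (S m))) : 𝓢(V, ℂ))) :
    Integrable (fun ξ : V => 𝓕 (⇑g) ξ / (((2 * π) ^ 2 * ‖ξ‖ ^ 2 : ℝ) : ℂ)) ∧
    Integrable (𝓕⁻ fun ξ : V => 𝓕 (⇑g) ξ / (((2 * π) ^ 2 * ‖ξ‖ ^ 2 : ℝ) : ℂ)) ∧
    Continuous (𝓕⁻ fun ξ : V => 𝓕 (⇑g) ξ / (((2 * π) ^ 2 * ‖ξ‖ ^ 2 : ℝ) : ℂ)) := by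
  classical
  -- the multipliers of the individual terms
  set q : α → V → ℂ := fun m ξ =>
    𝓕 (⇑(∂_{a m} (∂_{b m} (∂_{c m} (S m))) : 𝓢(V, ℂ))) ξ / (((2 * π) ^ 2 * ‖ξ‖ ^ 2 : ℝ) : ℂ)
    with hq
  have hqi : ∀ m ∈ s, Integrable (q m) := fun m _ =>
    integrable_fourier_lineDeriv₃_div_normSq (S m) (a m) (b m) (c m)
  have hqF : ∀ m ∈ s, Integrable (𝓕⁻ (q m)) ∧ Continuous (𝓕⁻ (q m)) := fun m _ =>
    integrable_fourierInv_fourier_lineDeriv₃_div_normSq (S m) (a m) (b m) (c m)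
  -- the multiplier of `g` is their sum
  have hsum : (fun ξ : V => 𝓕 (⇑g) ξ / (((2 * π) ^ 2 * ‖ξ‖ ^ 2 : ℝ) : ℂ)) = ∑ m ∈ s, q m := by
    funext ξ
    rw [Finset.sum_apply]
    simp only [hq, ← Finset.sum_div]
    congr 1
    rw [← SchwartzMap.fourier_coe, hg, FourierTransform.fourier_sum, sum_apply]
    simp only [SchwartzMap.fourier_coe]
  rw [hsum, fourierInv_finset_sum s hqi]
  refine ⟨integrable_finsetSum' s hqi, integrable_finsetSum' s fun m hm => (hqF m hm).1, ?_⟩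
  have h := continuous_finsetSum s fun m hm => (hqF m hm).2
  convert h using 1
  exact Finset.sum_fn s fun m => 𝓕⁻ (q m)

end Multiplier


end Literature.Analysis.FluidPDE
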